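import Mathlib.Data.Matrix.Basic
import Mathlib.LinearAlgebra.Matrix.Notation
import Mathlib.Algebra.Order.Field.Rat
import Mathlib.Algebra.BigOperators.Fin
import HarnessLib

/-!
# List-backed data carriers for certificates (`matrixOfRows`, `vecOfList`, `funOfList`)

Compute-infrastructure file (unit `infra-psd-sos-lp-checker`). The certificate predicates of this
directory are indexed by `Fin n` (`Matrix (Fin m) (Fin n) ℚ`, `Fin m → ℚ`, `Fin s → Monomial`),
and the natural way to write such data, Mathlib's vector/matrix literals `![…]` / `!![…]`, has two
measured drawbacks for LARGE data (2026-08-16, farm, `35 × 35` rational matrix):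
* `native_decide` first COMPILES the literal, and the code generator is pathologically slow on long
  `![…]` chains (`> 10 min` at `35 × 35`, versus `4 s` for the same data given as a `List`);
* elaboration of nested literals is fast only with type ascriptions on every inner list.
The carriers below read a plain `List` literal (which elaborates and compiles linearly) through
`List.getD` with a junk default past the end (documented; a certificate predicate quantifies over
`Fin n` only, so the default is never consulted when the list has the stated length — and if it
is, the predicate is simply checked on that junk value, soundness is unaffected). They work
equally with `decide +kernel` (slightly FASTER than `!![…]` in the kernel: `7 s` vs `9 s` for the
`35 × 35` symmetry check) and with `native_decide`.

Usage: `PSD.IsGramCertZ (matrixOfRows n n Arows) (vecOfList m dList) (matrixOfRows m n Brows)`,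
`GramSOS.mb := funOfList [] s monoList`, `LP.IsIneqCert (matrixOfRows m n Arows) (vecOfList m b) …`.

[folklore] throughout.
-/

namespace Literature.Computation.Certificates

/-- A `Fin n → α` vector read from a list, with an explicit default past its end. [folklore] -/
def funOfList {α : Type*} (default : α) (n : ℕ) (l : List α) : Fin n → α :=
  fun i => l.getD i.val default

/-- A `Fin n → α` vector read from a list (default `0` past its end). [folklore] -/
def vecOfList {α : Type*} [Zero α] (n : ℕ) (l : List α) : Fin n → α :=
  funOfList 0 n l

/-- An `m × n` matrix read from a list of rows (default `0` past the end of a row or of the row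
list). [folklore] -/
def matrixOfRows {α : Type*} [Zero α] (m n : ℕ) (rows : List (List α)) : Matrix (Fin m) (Fin n) α :=
  fun i j => (rows.getD i.val []).getD j.val 0

/-- `funOfList` unfolds to `List.getD`. [folklore] -/
@[simp] theorem funOfList_apply {α : Type*} (d : α) (n : ℕ) (l : List α) (i : Fin n) :
    funOfList d n l i = l.getD i.val d := rfl

/-- `vecOfList` unfolds to `List.getD`. [folklore] -/
@[simp] theorem vecOfList_apply {α : Type*} [Zero α] (n : ℕ) (l : List α) (i : Fin n) :
    vecOfList n l i = l.getD i.val 0 := rfl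

/-- `matrixOfRows` unfolds to two `List.getD`s. [folklore] -/
@[simp] theorem matrixOfRows_apply {α : Type*} [Zero α] (m n : ℕ) (rows : List (List α))
    (i : Fin m) (j : Fin n) : matrixOfRows m n rows i j = (rows.getD i.val []).getD j.val 0 := rfl

/-- A list-backed matrix agrees with the corresponding `!![…]` literal (checked entrywise by the
kernel on an example; the general statement is `rfl` entry by entry). [folklore] -/
theorem matrixOfRows_eq_of_forall {α : Type*} [Zero α] {m n : ℕ} {rows : List (List α)}
    {A : Matrix (Fin m) (Fin n) α} (h : ∀ i j, (rows.getD i.val []).getD j.val 0 = A i j) :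
    matrixOfRows m n rows = A :=
  funext fun i => funext fun j => h i j

/-! ### Tests (kernel-checked) -/

/-- Test: a list-backed `3 × 3` rational matrix equals its `!![…]` form (entrywise `decide`). -/
example : matrixOfRows 3 3 [[2, -1, 0], [-1, 2, -1], [0, -1, 2]] =
    (!![2, -1, 0; -1, 2, -1; 0, -1, 2] : Matrix (Fin 3) (Fin 3) ℚ) :=
  matrixOfRows_eq_of_forall (by decide +kernel)

/-- Test: a decidable `Fin`-indexed statement over list-backed data (symmetry and a weighted row
sum), the shape of every certificate predicate in this directory. -/
example : (∀ i j : Fin 3, matrixOfRows 3 3 [[2, -1, 0], [-1, 2, -1], [0, -1, (2 : ℚ)]] i j =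
      matrixOfRows 3 3 [[2, -1, 0], [-1, 2, -1], [0, -1, (2 : ℚ)]] j i) ∧
    ∀ i : Fin 3, ∑ j, vecOfList 3 [(1 : ℚ), 1, 1] j *
      matrixOfRows 3 3 [[2, -1, 0], [-1, 2, -1], [0, -1, (2 : ℚ)]] i j ≤ 1 := by
  decide +kernel

/-- Test: `funOfList` with a non-numeric payload (exponent vectors, default `[]`). -/
example : (funOfList ([] : List ℕ) 2 [[1], [0, 1]]) 1 = [0, 1] := by decide +kernel

end Literature.Computation.Certificates
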